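import Mathlib
import Summits.ValiantsHypothesis.ValiantsHypothesis.Theorems.NewtonUnitEquationsNewtonTauWeakCoreDesignKillSwitch

/-!
# The kill criterion of the sign-design family (lead c7, line `binomial-normal-form`, crux `NewtonTauWeak`)

`not_T2_of_designs`: if for every exponent `b` some `c`-core design has more than `(2^{x+c}·(c·2^x)+2)^b`
strictly positively exposed configuration points, then the open stub T2 (`BinomialNewtonTauCommon` of the
line's skeleton, here spelled out) is false — the contrapositive of P14 `stub_coreDesignKillSwitch`.
By `coreChart_logBound` such designs need `c ≥ 2^{4^b}` cores; by the three-bin-law conjecture of the card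
(`Cruxes/NewtonTauWeak/Lines/binomial-normal-form-c7.md` §9) they do not exist.
-/

-- Sub = Summit single-conjunct layout: the duplicated namespace component is mandated by the tree.
set_option linter.dupNamespace false

open scoped BigOperators
open MvPolynomial
open Summit.ValiantsHypothesis.ValiantsHypothesis.Theorems.NewtonTauWeak.Negative (vert)

namespace Summit.ValiantsHypothesis.ValiantsHypothesis.Theorems.NewtonUnitEquationsNewtonTauWeak

/-- **Kill criterion.**  Designs beating the allowance `(2^{x+c}·(c·2^x)+2)^b` for every `b` refute the common-exponent
binomial form of T2. -/
theorem not_T2_of_designs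
    (hbig : ∀ b : ℕ, ∃ (c x : ℕ) (h : Fin c → Finset (Fin x) → (Fin 2 →₀ ℕ)),
      (2 ^ (x + c) * (c * 2 ^ x) + 2) ^ b <
        {q : Fin 2 →₀ ℕ | (∃ f : Fin x → Fin c, ∑ d, h d (Finset.univ.filter fun u => f u = d) = q ∧
          ∃ w : Fin 2 → ℝ, 0 < w 0 ∧ 0 < w 1 ∧ ∀ f' : Fin x → Fin c,
            ∑ d, h d (Finset.univ.filter fun u => f' u = d) ≠ q →
            w 0 * ((q 0 : ℕ) : ℝ) + w 1 * ((q 1 : ℕ) : ℝ) <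
              w 0 * (((∑ d, h d (Finset.univ.filter fun u => f' u = d)) 0 : ℕ) : ℝ) +
                w 1 * (((∑ d, h d (Finset.univ.filter fun u => f' u = d)) 1 : ℕ) : ℝ))}.ncard) :
    ¬ ∃ b : ℕ, ∀ (K N : ℕ) (c : Fin K → ℂ) (ρ : Fin K → Fin N → ℂ) (d : Fin N → (Fin 2 →₀ ℕ)),
      vert (∑ l, C (c l) * ∏ j, (1 - C (ρ l j) * monomial (d j) 1)) ≤ (K * N + 2) ^ b := by
  rintro ⟨b, hb⟩
  obtain ⟨c, x, h, hlt⟩ := hbig b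
  exact absurd (stub_coreDesignKillSwitch b hb c x h) (not_le.mpr hlt)

end Summit.ValiantsHypothesis.ValiantsHypothesis.Theorems.NewtonUnitEquationsNewtonTauWeak
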